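import Summits.QuantumFields.QCD.Theses.QuarksAsStableAction
import Literature.MathematicalPhysics.QuantumLattice.WilsonDiracAP
import Summits.QuantumFields.QCD.Theorems.QuarksAsStableActionCriticalLineDiamagnetismStubBlochFactorisation
import Summits.QuantumFields.QCD.Theorems.QuarksAsStableActionCriticalLineDiamagnetismStubFrequencyFactorisationAux

/-!
# Frequency factorisation of the Wilson determinant of a statically lifted 2D field
(crux stmt-QuantumFields-9734 `…QuarksAsStableAction.CriticalLineDiamagnetism`, line `Sketch`,
stub `stub_frequencyFactorisation` of the static route for odd tori)

For a 2D field `A : (ℤ/L)² → Fin 4 → U(3)` let `lift A` be the `U(3)` field on `(ℤ/L)⁴` with the antiperiodic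
`±1` pattern on the `0,1`-links and the seam-signed `A(x₂,x₃,j)` on the `j = 2,3`-links.  Then (`r = 1`, mass `m`)
`det D_W[lift A] = ∏_{k₀,k₁ : Fin L} det fD(A, m, π(2k₀+1)/L, π(2k₁+1)/L)` with the 2D FREQUENCY OPERATOR
`fD = [(m + 4 - cos ω₀ - cos ω₁)·1 + i(sin ω₀ γ₀ + sin ω₁ γ₁)] ⊗ 1
      - ½ Σ_{j=2,3} [(1-γ_j)(±A) fwd + (1+γ_j)(±A)ᴴ bwd]`
on `(ℤ/L)² × Fin 3 × Fin 4` (`stub_frequencyFactorisation`).  Proof.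
1. GAUGE (`gaugeTransform_eq_lift`, aux. file): `lift A` is the gauge transform by `x ↦ ω^{val x₀ + val x₁}`,
   `ω = e^{iπ/L}·1`, of the field `V` with the constant phase `ω` on the `0,1`-links and the same `2,3`-links;
   `det D_W` is gauge invariant (`fermionDet_wilsonDirac_gaugeTransform`).
2. PARTIAL PLANE WAVES `P((x,a,α),(s,k)) = [((x₂,x₃),a,α) = s] χ_k(x)`, `χ_k(x) = e(k₀x₀)e(k₁x₁)`: the hops
   of `D_W[V] = (m+4)·1 - ½Σ_μ(H⁺_μ + H⁻_μ)` (`wilsonDirac_eq`) act by `H^±_μ P = P · blockDiagonal(…)`: in the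
   directions `μ = 0,1` the constant link `e^{iπ/L}` and `χ_k(x ± e_μ) = e(±k_μ)χ_k(x)` give the phases
   `e^{±iφ_μ}`, `φ_μ = π(2k_μ+1)/L`, and `-½[(1-γ_μ)e^{iφ} + (1+γ_μ)e^{-iφ}] = -cos φ·1 + i sin φ·γ_μ`
   (`hopFwd_phase_mul_P`, `hopBwd_phase_mul_P`); in the directions `2,3` the hop moves `(x₂,x₃)` and `χ_k`
   is unchanged (`hopFwd_field_mul_P`, `hopBwd_field_mul_P`).  Summing: `D_W[V] P = P · blockDiagonal_k fD(φ_k)`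
   (`wilsonDirac_mul_P`).
3. DETERMINANT: `Pᴴ P = L² • 1` and the index types are equinumerous, so
   `det D_W[V] = det blockDiagonal = ∏_k det fD(φ_k)` (`BlochFactorisation.det_eq_of_intertwine`,
   `Matrix.det_blockDiagonal`; `det_wilsonDirac_V`, `det_wilsonDirac_lift`).
References: Montvay–Münster, *Quantum Fields on a Lattice* §4.2.4 (4.112)–(4.119) (antiperiodic Wilson fermions
in momentum space), §5.1.1 (5.3)–(5.5) (gauge invariance); folklore (partial Fourier / Bloch reduction).
Pure theorem file (no `def`s): `ω, V, χ, P, F, Λ` are variables with defining hypotheses, instantiated by `rfl`.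
-/

noncomputable section

open scoped BigOperators Matrix ComplexConjugate
open Finset
open Literature.MathematicalPhysics.QuantumLattice Literature.MathematicalPhysics.QuantumFieldTheory
  Literature.Probability.LatticeModels

namespace Summit.QuantumFields.QCD.Cruxes.CriticalLineDiamagnetism.ChessboardCellGain
namespace FrequencyFactorisation

open Complex (I)
open Literature.MathematicalPhysics (QuantumFieldTheory.Site.shift)

variable {L : ℕ} [NeZero L] (A : ZMod L → ZMod L → Fin 4 → Matrix.unitaryGroup (Fin 3) ℂ) (m : ℝ)
  (ω : Matrix.unitaryGroup (Fin 3) ℂ)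
  (hω : (ω : Matrix (Fin 3) (Fin 3) ℂ) = Complex.exp (↑(Real.pi / L) * I) • (1 : Matrix (Fin 3) (Fin 3) ℂ))
  (V : GaugeConfig 4 L (Matrix.unitaryGroup (Fin 3) ℂ))
  (hV : V = fun e => if e.2 = 0 ∨ e.2 = 1 then ω
    else (if e.1 e.2 = -1 then -(A (e.1 2) (e.1 3) e.2) else A (e.1 2) (e.1 3) e.2))
  (χ : Fin L × Fin L → TorusSite 4 L → ℂ)
  (hχ : χ = fun k x => (ZMod.stdAddChar (((k.1 : ℕ) : ZMod L) * x 0) : ℂ) *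
    (ZMod.stdAddChar (((k.2 : ℕ) : ZMod L) * x 1) : ℂ))
  (P : Matrix (TorusSite 4 L × Fin 3 × Fin 4) (((ZMod L × ZMod L) × Fin 3 × Fin 4) × (Fin L × Fin L)) ℂ)
  (hP : P = Matrix.of fun p q => if ((p.1 2, p.1 3), p.2) = q.1 then χ q.2 p.1 else 0)

/-! ### The hops of `D_W[V]` on the partial plane waves -/

include hω hV hχ hP in
/-- **Forward phase hops** (`μ = 0, 1`):
`(H⁺_μ P)(p,(s,k)) = χ_k(x) [(x₂,x₃) = s₁ ∧ a = b] (1 - γ_μ)_{αβ} e^{iφ_μ}`,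
`e^{iφ_μ} = cos φ_μ + i sin φ_μ`, `φ_μ = π(2κ_μ(k)+1)/L`. -/
theorem hopFwd_phase_mul_P {μ : Fin 4} (hμ : μ = 0 ∨ μ = 1) (κ : Fin L × Fin L → ℕ)
    (hκ : ∀ k, χ k (Pi.single μ 1) = (ZMod.stdAddChar ((κ k : ℕ) : ZMod L) : ℂ))
    (p : TorusSite 4 L × Fin 3 × Fin 4) (q : ((ZMod L × ZMod L) × Fin 3 × Fin 4) × (Fin L × Fin L)) :
    (wilsonHopFwd (unitaryFundamentalRep (Fin 3) ℂ) V 1 μ * P) p q =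
      χ q.2 p.1 * (if (p.1 2, p.1 3) = q.1.1 ∧ p.2.1 = q.1.2.1 then
        ((1 : Matrix (Fin 4) (Fin 4) ℂ) - euclideanGamma μ) p.2.2 q.1.2.2 *
          (((Real.cos (Real.pi * (2 * κ q.2 + 1) / L) : ℝ) : ℂ) +
            ((Real.sin (Real.pi * (2 * κ q.2 + 1) / L) : ℝ) : ℂ) * I) else 0) := by
  have h2 : (2 : Fin 4) ≠ μ := by rcases hμ with rfl | rfl <;> decide
  have h3 : (3 : Fin 4) ≠ μ := by rcases hμ with rfl | rfl <;> decide
  rw [rowHop_mul_P_apply χ P hP _ (fun p => QuantumFieldTheory.Site.shift p.1 μ)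
    (fun p c => ((1 : Matrix (Fin 4) (Fin 4) ℂ) - euclideanGamma μ) p.2.2 c.2 *
      (Complex.exp (↑(Real.pi / L) * I) * (1 : Matrix (Fin 3) (Fin 3) ℂ) p.2.1 c.1)) ?_]
  · rw [FreeDetFormula.shift_apply_of_ne _ h2, FreeDetFormula.shift_apply_of_ne _ h3]
    unfold QuantumFieldTheory.Site.shift
    rw [char_add χ hχ, hκ, Matrix.one_apply]
    by_cases h1 : (p.1 2, p.1 3) = q.1.1
    · by_cases hab : p.2.1 = q.1.2.1
      · rw [if_pos h1, if_pos (And.intro h1 hab), if_pos hab, ← phase_mul_stdAddChar]; ring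
      · rw [if_pos h1, if_neg (fun h : _ ∧ _ => hab h.2), if_neg hab]; ring
    · rw [if_neg h1, if_neg (fun h : _ ∧ _ => h1 h.1), mul_zero]
  · intro p p'
    simp only [wilsonHopFwd, Matrix.of_apply, Complex.ofReal_one, one_smul, unitaryFundamentalRep_apply,
      V_apply_phase A ω V hV _ hμ, hω, Matrix.smul_apply, smul_eq_mul]

include hω hV hχ hP in
/-- **Backward phase hops** (`μ = 0, 1`):
`(H⁻_μ P)(p,(s,k)) = χ_k(x) [(x₂,x₃) = s₁ ∧ a = b] (1 + γ_μ)_{αβ} e^{-iφ_μ}`. -/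
theorem hopBwd_phase_mul_P {μ : Fin 4} (hμ : μ = 0 ∨ μ = 1) (κ : Fin L × Fin L → ℕ)
    (hκ : ∀ k, χ k (Pi.single μ 1) = (ZMod.stdAddChar ((κ k : ℕ) : ZMod L) : ℂ))
    (p : TorusSite 4 L × Fin 3 × Fin 4) (q : ((ZMod L × ZMod L) × Fin 3 × Fin 4) × (Fin L × Fin L)) :
    (wilsonHopBwd (unitaryFundamentalRep (Fin 3) ℂ) V 1 μ * P) p q =
      χ q.2 p.1 * (if (p.1 2, p.1 3) = q.1.1 ∧ p.2.1 = q.1.2.1 then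
        ((1 : Matrix (Fin 4) (Fin 4) ℂ) + euclideanGamma μ) p.2.2 q.1.2.2 *
          (((Real.cos (Real.pi * (2 * κ q.2 + 1) / L) : ℝ) : ℂ) -
            ((Real.sin (Real.pi * (2 * κ q.2 + 1) / L) : ℝ) : ℂ) * I) else 0) := by
  have h2 : (2 : Fin 4) ≠ μ := by rcases hμ with rfl | rfl <;> decide
  have h3 : (3 : Fin 4) ≠ μ := by rcases hμ with rfl | rfl <;> decide
  have he : ∀ z y : TorusSite 4 L, z = QuantumFieldTheory.Site.shift y μ ↔ y = z - Pi.single μ 1 :=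
    fun z y => by unfold QuantumFieldTheory.Site.shift; rw [eq_sub_iff_add_eq, eq_comm]
  rw [rowHop_mul_P_apply χ P hP _ (fun p => p.1 - Pi.single μ 1)
    (fun p c => ((1 : Matrix (Fin 4) (Fin 4) ℂ) + euclideanGamma μ) p.2.2 c.2 *
      (Complex.exp (-(↑(Real.pi / L) * I)) * (1 : Matrix (Fin 3) (Fin 3) ℂ) p.2.1 c.1)) ?_]
  · simp only [Pi.sub_apply, Pi.single_eq_of_ne h2, Pi.single_eq_of_ne h3, sub_zero]
    rw [char_sub χ hχ, hκ, Matrix.one_apply]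
    by_cases h1 : (p.1 2, p.1 3) = q.1.1
    · by_cases hab : p.2.1 = q.1.2.1
      · rw [if_pos h1, if_pos (And.intro h1 hab), if_pos hab, ← conj_phase_mul_stdAddChar]; ring
      · rw [if_pos h1, if_neg (fun h : _ ∧ _ => hab h.2), if_neg hab]; ring
    · rw [if_neg h1, if_neg (fun h : _ ∧ _ => h1 h.1), mul_zero]
  · intro p p'
    by_cases h : p'.1 = p.1 - Pi.single μ 1
    · simp only [wilsonHopBwd, Matrix.of_apply, he, if_pos h, Complex.ofReal_one, one_smul,
        unitaryFundamentalRep_apply, Matrix.UnitaryGroup.inv_apply, V_apply_phase A ω V hV _ hμ, hω,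
        WilsonQuarkStability.FreeTangentLandauChessboard.star_exp_smul_one, Matrix.smul_apply, smul_eq_mul]
    · simp only [wilsonHopBwd, Matrix.of_apply, he, if_neg h]

include hV hχ hP in
/-- **Forward field hops** (`μ = 2, 3`):
`(H⁺_μ P)(p,(s,k)) = χ_k(x) [s₁ = (x₂,x₃) + e_μ] (1 - γ_μ)_{αβ} (±A(x₂,x₃,μ))_{ab}`. -/
theorem hopFwd_field_mul_P {μ : Fin 4} (hμ : ¬(μ = 0 ∨ μ = 1)) (σ : ZMod L × ZMod L → ZMod L × ZMod L)
    (hσ : ∀ x : TorusSite 4 L,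
      ((QuantumFieldTheory.Site.shift x μ) 2, (QuantumFieldTheory.Site.shift x μ) 3) = σ (x 2, x 3))
    (hχμ : ∀ k, χ k (Pi.single μ 1) = 1)
    (p : TorusSite 4 L × Fin 3 × Fin 4) (q : ((ZMod L × ZMod L) × Fin 3 × Fin 4) × (Fin L × Fin L)) :
    (wilsonHopFwd (unitaryFundamentalRep (Fin 3) ℂ) V 1 μ * P) p q =
      χ q.2 p.1 * (if q.1.1 = σ (p.1 2, p.1 3) then
        ((1 : Matrix (Fin 4) (Fin 4) ℂ) - euclideanGamma μ) p.2.2 q.1.2.2 *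
          ((if p.1 μ = -1 then (-1 : ℂ) else 1) * (A (p.1 2) (p.1 3) μ : Matrix (Fin 3) (Fin 3) ℂ) p.2.1 q.1.2.1)
        else 0) := by
  rw [rowHop_mul_P_apply χ P hP _ (fun p => QuantumFieldTheory.Site.shift p.1 μ)
    (fun p c => ((1 : Matrix (Fin 4) (Fin 4) ℂ) - euclideanGamma μ) p.2.2 c.2 *
      ((if p.1 μ = -1 then (-1 : ℂ) else 1) * (A (p.1 2) (p.1 3) μ : Matrix (Fin 3) (Fin 3) ℂ) p.2.1 c.1)) ?_]
  · rw [hσ]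
    unfold QuantumFieldTheory.Site.shift
    rw [char_add χ hχ, hχμ, mul_one]
    by_cases h : σ (p.1 2, p.1 3) = q.1.1
    · rw [if_pos h, if_pos h.symm, mul_comm]
    · rw [if_neg h, if_neg (fun h' => h h'.symm), mul_zero]
  · intro p p'
    simp only [wilsonHopFwd, Matrix.of_apply, Complex.ofReal_one, one_smul, unitaryFundamentalRep_apply,
      V_apply_field A ω V hV _ hμ, coe_seam_apply]

include hV hχ hP in
/-- **Backward field hops** (`μ = 2, 3`):
`(H⁻_μ P)(p,(s,k)) = χ_k(x) [(x₂,x₃) = s₁ + e_μ] (1 + γ_μ)_{αβ} (±A(s₁,μ))ᴴ_{ab}`. -/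
theorem hopBwd_field_mul_P {μ : Fin 4} (hμ : ¬(μ = 0 ∨ μ = 1)) (σ : ZMod L × ZMod L → ZMod L × ZMod L)
    (τ : ZMod L × ZMod L → ZMod L)
    (hσ : ∀ (x : TorusSite 4 L) (t : ZMod L × ZMod L),
      ((x - Pi.single μ 1 : TorusSite 4 L) 2, (x - Pi.single μ 1 : TorusSite 4 L) 3) = t ↔ (x 2, x 3) = σ t)
    (hτ : ∀ x : TorusSite 4 L, τ (x 2, x 3) = x μ) (hχμ : ∀ k, χ k (Pi.single μ 1) = 1)
    (p : TorusSite 4 L × Fin 3 × Fin 4) (q : ((ZMod L × ZMod L) × Fin 3 × Fin 4) × (Fin L × Fin L)) :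
    (wilsonHopBwd (unitaryFundamentalRep (Fin 3) ℂ) V 1 μ * P) p q =
      χ q.2 p.1 * (if (p.1 2, p.1 3) = σ q.1.1 then
        ((1 : Matrix (Fin 4) (Fin 4) ℂ) + euclideanGamma μ) p.2.2 q.1.2.2 *
          ((if τ q.1.1 = -1 then (-1 : ℂ) else 1) *
            (star (A q.1.1.1 q.1.1.2 μ : Matrix (Fin 3) (Fin 3) ℂ)) p.2.1 q.1.2.1)
        else 0) := by
  have he : ∀ z y : TorusSite 4 L, z = QuantumFieldTheory.Site.shift y μ ↔ y = z - Pi.single μ 1 :=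
    fun z y => by unfold QuantumFieldTheory.Site.shift; rw [eq_sub_iff_add_eq, eq_comm]
  rw [rowHop_mul_P_apply χ P hP _ (fun p => p.1 - Pi.single μ 1)
    (fun p c => ((1 : Matrix (Fin 4) (Fin 4) ℂ) + euclideanGamma μ) p.2.2 c.2 *
      ((if (p.1 - Pi.single μ 1 : TorusSite 4 L) μ = -1 then (-1 : ℂ) else 1) *
        (star (A ((p.1 - Pi.single μ 1 : TorusSite 4 L) 2) ((p.1 - Pi.single μ 1 : TorusSite 4 L) 3) μ :
          Matrix (Fin 3) (Fin 3) ℂ)) p.2.1 c.1)) ?_]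
  · obtain ⟨⟨t, c⟩, k⟩ := q
    rw [char_sub χ hχ, hχμ, map_one, mul_one]
    by_cases h : ((p.1 - Pi.single μ 1 : TorusSite 4 L) 2, (p.1 - Pi.single μ 1 : TorusSite 4 L) 3) = t
    · rw [if_pos h, if_pos ((hσ p.1 t).1 h)]
      subst h
      rw [hτ, mul_comm]
    · rw [if_neg h, if_neg (fun h' => h ((hσ p.1 t).2 h')), mul_zero]
  · intro p p'
    by_cases h : p'.1 = p.1 - Pi.single μ 1
    · simp only [wilsonHopBwd, Matrix.of_apply, he, if_pos h, Complex.ofReal_one, one_smul,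
        unitaryFundamentalRep_apply, Matrix.UnitaryGroup.inv_apply]
      rw [h, V_apply_field A ω V hV _ hμ, star_coe_seam_apply]
    · simp only [wilsonHopBwd, Matrix.of_apply, he, if_neg h]

/-! ### The intertwining `D_W[V] P = P · blockDiagonal_k fD(φ_k)` and the determinant -/

variable (F : ℝ → ℝ → Matrix ((ZMod L × ZMod L) × Fin 3 × Fin 4) ((ZMod L × ZMod L) × Fin 3 × Fin 4) ℂ)
  (hF : F = fun ω₀ ω₁ => Matrix.of fun (p q : (ZMod L × ZMod L) × Fin 3 × Fin 4) =>
        (if p.1 = q.1 ∧ p.2.1 = q.2.1 then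
            (((m + 4 - Real.cos ω₀ - Real.cos ω₁ : ℝ) : ℂ) * (1 : Matrix (Fin 4) (Fin 4) ℂ) p.2.2 q.2.2 +
              Complex.I * (((Real.sin ω₀ : ℝ) : ℂ) * euclideanGamma 0 p.2.2 q.2.2 +
                ((Real.sin ω₁ : ℝ) : ℂ) * euclideanGamma 1 p.2.2 q.2.2))
          else 0) -
          (1 / 2 : ℂ) *
            ((if q.1 = (p.1.1 + 1, p.1.2) then
                ((1 : Matrix (Fin 4) (Fin 4) ℂ) - euclideanGamma 2) p.2.2 q.2.2 *
                  ((if p.1.1 = -1 then (-1 : ℂ) else 1) * (A p.1.1 p.1.2 2 : Matrix (Fin 3) (Fin 3) ℂ) p.2.1 q.2.1)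
              else 0) +
             (if p.1 = (q.1.1 + 1, q.1.2) then
                ((1 : Matrix (Fin 4) (Fin 4) ℂ) + euclideanGamma 2) p.2.2 q.2.2 *
                  ((if q.1.1 = -1 then (-1 : ℂ) else 1) * (star (A q.1.1 q.1.2 2 : Matrix (Fin 3) (Fin 3) ℂ)) p.2.1 q.2.1)
              else 0) +
             (if q.1 = (p.1.1, p.1.2 + 1) then
                ((1 : Matrix (Fin 4) (Fin 4) ℂ) - euclideanGamma 3) p.2.2 q.2.2 *
                  ((if p.1.2 = -1 then (-1 : ℂ) else 1) * (A p.1.1 p.1.2 3 : Matrix (Fin 3) (Fin 3) ℂ) p.2.1 q.2.1)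
              else 0) +
             (if p.1 = (q.1.1, q.1.2 + 1) then
                ((1 : Matrix (Fin 4) (Fin 4) ℂ) + euclideanGamma 3) p.2.2 q.2.2 *
                  ((if q.1.2 = -1 then (-1 : ℂ) else 1) * (star (A q.1.1 q.1.2 3 : Matrix (Fin 3) (Fin 3) ℂ)) p.2.1 q.2.1)
              else 0)))

include hω hV hχ hP hF in
/-- **The partial plane waves block-diagonalise `D_W[V]`**: `D_W[V] P = P · blockDiagonal_k fD(φ(k₀), φ(k₁))`,
`φ(k) = π(2k+1)/L`. -/
theorem wilsonDirac_mul_P :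
    wilsonDirac (unitaryFundamentalRep (Fin 3) ℂ) V m 1 * P =
      P * Matrix.blockDiagonal fun k : Fin L × Fin L =>
        F (Real.pi * (2 * (k.1 : ℕ) + 1) / L) (Real.pi * (2 * (k.2 : ℕ) + 1) / L) := by
  have hκ0 : ∀ k, χ k (Pi.single 0 1) = (ZMod.stdAddChar ((k.1 : ℕ) : ZMod L) : ℂ) := fun k => by
    rw [char_single χ hχ, if_pos rfl]
  have hκ1 : ∀ k, χ k (Pi.single 1 1) = (ZMod.stdAddChar ((k.2 : ℕ) : ZMod L) : ℂ) := fun k => by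
    rw [char_single χ hχ, if_neg (by decide), if_pos rfl]
  have hχ2 : ∀ k, χ k (Pi.single 2 1) = 1 := fun k => by
    rw [char_single χ hχ, if_neg (by decide), if_neg (by decide)]
  have hχ3 : ∀ k, χ k (Pi.single 3 1) = 1 := fun k => by
    rw [char_single χ hχ, if_neg (by decide), if_neg (by decide)]
  have hσ2 : ∀ x : TorusSite 4 L, ((QuantumFieldTheory.Site.shift x 2) 2, (QuantumFieldTheory.Site.shift x 2) 3) =
      (fun t : ZMod L × ZMod L => (t.1 + 1, t.2)) (x 2, x 3) := fun x => by
    rw [FreeDetFormula.shift_apply_self, FreeDetFormula.shift_apply_of_ne x (by decide : (3 : Fin 4) ≠ 2)]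
  have hσ3 : ∀ x : TorusSite 4 L, ((QuantumFieldTheory.Site.shift x 3) 2, (QuantumFieldTheory.Site.shift x 3) 3) =
      (fun t : ZMod L × ZMod L => (t.1, t.2 + 1)) (x 2, x 3) := fun x => by
    rw [FreeDetFormula.shift_apply_self, FreeDetFormula.shift_apply_of_ne x (by decide : (2 : Fin 4) ≠ 3)]
  have hσ2' : ∀ (x : TorusSite 4 L) (t : ZMod L × ZMod L),
      ((x - Pi.single 2 1 : TorusSite 4 L) 2, (x - Pi.single 2 1 : TorusSite 4 L) 3) = t ↔
        (x 2, x 3) = (fun t : ZMod L × ZMod L => (t.1 + 1, t.2)) t := fun x t => by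
    obtain ⟨t₁, t₂⟩ := t
    simp only [Pi.sub_apply, Pi.single_eq_same, Pi.single_eq_of_ne (by decide : (3 : Fin 4) ≠ 2), sub_zero,
      Prod.mk.injEq, sub_eq_iff_eq_add]
  have hσ3' : ∀ (x : TorusSite 4 L) (t : ZMod L × ZMod L),
      ((x - Pi.single 3 1 : TorusSite 4 L) 2, (x - Pi.single 3 1 : TorusSite 4 L) 3) = t ↔
        (x 2, x 3) = (fun t : ZMod L × ZMod L => (t.1, t.2 + 1)) t := fun x t => by
    obtain ⟨t₁, t₂⟩ := t
    simp only [Pi.sub_apply, Pi.single_eq_same, Pi.single_eq_of_ne (by decide : (2 : Fin 4) ≠ 3), sub_zero,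
      Prod.mk.injEq, sub_eq_iff_eq_add]
  have hmc : ∀ c₀ c₁ : ℝ, ((m + 4 - c₀ - c₁ : ℝ) : ℂ) = (m : ℂ) + 4 - (c₀ : ℂ) - (c₁ : ℂ) :=
    fun _ _ => by push_cast; ring
  have hm4 : ((m + 4 * 1 : ℝ) : ℂ) = (m : ℂ) + 4 := by push_cast; ring
  ext ⟨x, a, α⟩ ⟨⟨t, b, β⟩, k⟩
  rw [P_mul_blockDiagonal_apply χ P hP, wilsonDirac_eq]
  simp only [Matrix.sub_mul, Matrix.smul_mul, Matrix.one_mul, Matrix.add_mul, Matrix.sub_apply,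
    Matrix.smul_apply, Matrix.add_apply, smul_eq_mul, Fin.sum_univ_four]
  rw [hopFwd_phase_mul_P A ω hω V hV χ hχ P hP (Or.inl rfl) (fun k => (k.1 : ℕ)) hκ0,
    hopBwd_phase_mul_P A ω hω V hV χ hχ P hP (Or.inl rfl) (fun k => (k.1 : ℕ)) hκ0,
    hopFwd_phase_mul_P A ω hω V hV χ hχ P hP (Or.inr rfl) (fun k => (k.2 : ℕ)) hκ1,
    hopBwd_phase_mul_P A ω hω V hV χ hχ P hP (Or.inr rfl) (fun k => (k.2 : ℕ)) hκ1,
    hopFwd_field_mul_P A ω V hV χ hχ P hP (μ := 2) (by decide) (fun t : ZMod L × ZMod L => (t.1 + 1, t.2)) hσ2 hχ2,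
    hopBwd_field_mul_P A ω V hV χ hχ P hP (μ := 2) (by decide) (fun t : ZMod L × ZMod L => (t.1 + 1, t.2))
      Prod.fst hσ2' (fun x => rfl) hχ2,
    hopFwd_field_mul_P A ω V hV χ hχ P hP (μ := 3) (by decide) (fun t : ZMod L × ZMod L => (t.1, t.2 + 1)) hσ3 hχ3,
    hopBwd_field_mul_P A ω V hV χ hχ P hP (μ := 3) (by decide) (fun t : ZMod L × ZMod L => (t.1, t.2 + 1))
      Prod.snd hσ3' (fun x => rfl) hχ3,
    hP, Matrix.of_apply, hF]
  dsimp only [Matrix.of_apply]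
  rw [hm4]
  by_cases h12 : (x 2, x 3) = t ∧ a = b
  · by_cases h3 : α = β
    · subst h3
      rw [if_pos (show ((x 2, x 3), a, α) = (t, b, α) by rw [h12.1, h12.2])]
      simp only [if_pos h12, Matrix.sub_apply, Matrix.add_apply, Matrix.one_apply_eq, hmc]
      ring
    · rw [if_neg (fun h => h3 (Prod.mk.inj (Prod.mk.inj h).2).2)]
      simp only [if_pos h12, Matrix.sub_apply, Matrix.add_apply, Matrix.one_apply_ne h3, hmc]
      ring
  · rw [if_neg (fun h => h12 ⟨(Prod.mk.inj h).1, (Prod.mk.inj (Prod.mk.inj h).2).1⟩)]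
    simp only [if_neg h12]
    ring

include hω hV hχ hP hF in
/-- `det D_W[V] = ∏_{k₀,k₁} det fD(φ(k₀), φ(k₁))` (conjugation by the partial plane waves, `Pᴴ P = L² • 1`,
`Matrix.det_blockDiagonal`). -/
theorem det_wilsonDirac_V :
    (wilsonDirac (unitaryFundamentalRep (Fin 3) ℂ) V m 1).det =
      ∏ k₀ : Fin L, ∏ k₁ : Fin L,
        (F (Real.pi * (2 * (k₀ : ℕ) + 1) / L) (Real.pi * (2 * (k₁ : ℕ) + 1) / L)).det := by
  have h := BlochFactorisation.det_eq_of_intertwine _ _ P (Fintype.equivOfCardEq (by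
      simp only [Fintype.card_prod, Fintype.card_fun, ZMod.card, Fintype.card_fin]; ring)) _
    (pow_ne_zero 2 (Nat.cast_ne_zero.2 (NeZero.ne L))) (P_conjTranspose_mul_self χ hχ P hP)
    (wilsonDirac_mul_P A m ω hω V hV χ hχ P hP F hF)
  rw [h, Matrix.det_blockDiagonal, Fintype.prod_prod_type]

include hω hF in
/-- `det D_W[lift A] = ∏_{k₀,k₁} det fD(φ(k₀), φ(k₁))`: gauge invariance of the Wilson fermion determinant
(`fermionDet_wilsonDirac_gaugeTransform`) and `det_wilsonDirac_V`. -/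
theorem det_wilsonDirac_lift (Λ : GaugeConfig 4 L (Matrix.unitaryGroup (Fin 3) ℂ))
    (hΛ : Λ = fun e : Edge 4 L => if e.2 = 0 ∨ e.2 = 1 then
        (if e.1 e.2 = -1 then (-1 : Matrix.unitaryGroup (Fin 3) ℂ) else 1)
        else (if e.1 e.2 = -1 then -(A (e.1 2) (e.1 3) e.2) else A (e.1 2) (e.1 3) e.2)) :
    (wilsonDirac (unitaryFundamentalRep (Fin 3) ℂ) Λ m 1).det =
      ∏ k₀ : Fin L, ∏ k₁ : Fin L,
        (F (Real.pi * (2 * (k₀ : ℕ) + 1) / L) (Real.pi * (2 * (k₁ : ℕ) + 1) / L)).det := by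
  rw [hΛ, ← gaugeTransform_eq_lift A ω hω _ rfl]
  exact (fermionDet_wilsonDirac_gaugeTransform _ _ _ m 1).trans
    (det_wilsonDirac_V A m ω hω _ rfl _ rfl _ rfl F hF)

end FrequencyFactorisation

open FrequencyFactorisation in
/-- **S2 `stub_frequencyFactorisation`** — for the doubly static lift of a 2D field, the Wilson determinant is the
product over the `L²` antiperiodic frequency pairs of the determinants of the 2D frequency operators (partial Fourier
transform in the directions `0, 1`, along which the lift is the antiperiodic pattern). -/
theorem stub_frequencyFactorisation :
    ∀ (L : ℕ) [NeZero L] (A : ZMod L → ZMod L → Fin 4 → Matrix.unitaryGroup (Fin 3) ℂ) (m : ℝ),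
    let fD := fun (A : ZMod L → ZMod L → Fin 4 → Matrix.unitaryGroup (Fin 3) ℂ) (m ω₀ ω₁ : ℝ) =>
      Matrix.of fun (p q : (ZMod L × ZMod L) × Fin 3 × Fin 4) =>
        (if p.1 = q.1 ∧ p.2.1 = q.2.1 then
            (((m + 4 - Real.cos ω₀ - Real.cos ω₁ : ℝ) : ℂ) * (1 : Matrix (Fin 4) (Fin 4) ℂ) p.2.2 q.2.2 +
              Complex.I * (((Real.sin ω₀ : ℝ) : ℂ) * euclideanGamma 0 p.2.2 q.2.2 +
                ((Real.sin ω₁ : ℝ) : ℂ) * euclideanGamma 1 p.2.2 q.2.2))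
          else 0) -
          (1 / 2 : ℂ) *
            ((if q.1 = (p.1.1 + 1, p.1.2) then
                ((1 : Matrix (Fin 4) (Fin 4) ℂ) - euclideanGamma 2) p.2.2 q.2.2 *
                  ((if p.1.1 = -1 then (-1 : ℂ) else 1) * (A p.1.1 p.1.2 2 : Matrix (Fin 3) (Fin 3) ℂ) p.2.1 q.2.1)
              else 0) +
             (if p.1 = (q.1.1 + 1, q.1.2) then
                ((1 : Matrix (Fin 4) (Fin 4) ℂ) + euclideanGamma 2) p.2.2 q.2.2 *
                  ((if q.1.1 = -1 then (-1 : ℂ) else 1) * (star (A q.1.1 q.1.2 2 : Matrix (Fin 3) (Fin 3) ℂ)) p.2.1 q.2.1)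
              else 0) +
             (if q.1 = (p.1.1, p.1.2 + 1) then
                ((1 : Matrix (Fin 4) (Fin 4) ℂ) - euclideanGamma 3) p.2.2 q.2.2 *
                  ((if p.1.2 = -1 then (-1 : ℂ) else 1) * (A p.1.1 p.1.2 3 : Matrix (Fin 3) (Fin 3) ℂ) p.2.1 q.2.1)
              else 0) +
             (if p.1 = (q.1.1, q.1.2 + 1) then
                ((1 : Matrix (Fin 4) (Fin 4) ℂ) + euclideanGamma 3) p.2.2 q.2.2 *
                  ((if q.1.2 = -1 then (-1 : ℂ) else 1) * (star (A q.1.1 q.1.2 3 : Matrix (Fin 3) (Fin 3) ℂ)) p.2.1 q.2.1)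
              else 0));
    let lift := fun (A : ZMod L → ZMod L → Fin 4 → Matrix.unitaryGroup (Fin 3) ℂ) (e : Edge 4 L) =>
      if e.2 = 0 ∨ e.2 = 1 then (if e.1 e.2 = -1 then (-1 : Matrix.unitaryGroup (Fin 3) ℂ) else 1)
      else (if e.1 e.2 = -1 then -(A (e.1 2) (e.1 3) e.2) else A (e.1 2) (e.1 3) e.2);
    (wilsonDirac (unitaryFundamentalRep (Fin 3) ℂ) (lift A) m 1).det =
      ∏ k₀ : Fin L, ∏ k₁ : Fin L,
        (fD A m (Real.pi * (2 * (k₀ : ℕ) + 1) / L) (Real.pi * (2 * (k₁ : ℕ) + 1) / L)).det := by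
  intro L _ A m fD lift
  exact det_wilsonDirac_lift A m ⟨_, FreeDetFormula.phase_mem_unitaryGroup L⟩ rfl (fD A m) rfl (lift A) rfl
end Summit.QuantumFields.QCD.Cruxes.CriticalLineDiamagnetism.ChessboardCellGain

end
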